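import Mathlib
import HarnessLib
import Summits.QuantumFields.YangMills.Theorems.ComplexCouplingChannelContinuumLegGivenGapAlternatingArraysDefs
import Summits.QuantumFields.YangMills.Theorems.ComplexCouplingChannelContinuumLegGivenGapProductToUniformDefs
import Summits.QuantumFields.YangMills.Theorems.ComplexCouplingChannelContinuumLegGivenGapPtuDerivativesNormaliser

/-!
# `ContinuumLegGivenGap` (stmt-QuantumFields-15828), line `alternating-curvature-arrays`: the registered stub `stub_ptuDerivatives` — derivative bounds of the Whitney system of `stub_productToUniform`

Piece 2 of the sub-skeleton of `stub_productToUniform` ((PB) ⇒ (UUVB)): given coverage `W ≥ 1` of the global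
normaliser `W = near + out + ∑∑ φ*` (landed Defs `…ProductToUniformDefs`), the normaliser is smooth, every piece weight
`φ̃_{m,v,z}/W` is smooth with compact support inside `tsupport φ̃_{m,v,z}`, the inner cut-offs obey the scale-invariant
bound `ℓ^j ‖D^j χ‖ ≤ c (c (p+1) (j+1)^4)^j`, and the piece weights obey `‖Dⁿ(φ̃/W)(y)‖ ≤ c (c (p+1)^8 (n+1)^8/ℓ)ⁿ` for
ALL `n`, with ONE absolute constant `c = 2⁴⁰` (`ℓ = a · cellSide m`).  Assembly of the four landed helpers:
`…PtuDerivativesOneDim` (Gevrey step `|θ⁽ⁱ⁾| ≤ 2¹⁴ 18ⁱ (i!)²` in geometric form, plateau, one-point cut-off, `1/f`),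
`…PtuDerivativesSupports` (level numerics, supports in the cores, cell geometry, adjacent levels of overlapping pieces),
`…PtuDerivativesBlocks` (global geometric bounds of `φ̃`, `φ*`, `near`, `out`), `…PtuDerivativesNormaliser`
(`‖Dⁱ W‖` on `tsupport φ̃` with multiplicity `≤ 3(2p+1)^4`, `1/W` by Faà di Bruno, Leibniz).  This file only converts
the explicit polynomial constants of the helpers into the registered shape. [folklore]
-/

set_option autoImplicit false

noncomputable section

open scoped Classical

namespace Summit.QuantumFields.YangMills.Theorems.ContinuumLegGivenGap

open scoped BigOperators ContDiff
open Filter Topology Set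
open Summit.QuantumFields.YangMills.Theorems.ContinuumLegGivenGap.AlternatingArrays

/-- The polynomial constant of the weight bound is at most `2¹⁰ (p+1)⁶`. [folklore] -/
theorem stub_ptuDerivatives_poly_le (p : ℕ) :
    2 * (p : ℝ) * (2 * p + 1) + (2 + 3 * (2 * (p : ℝ) + 1) ^ 4) * (6 * (p : ℝ) * (2 * p + 1)) ≤
      2 ^ 10 * ((p : ℝ) + 1) ^ 6 := by
  set q : ℝ := (p : ℝ) + 1 with hq
  have hp0 : (0 : ℝ) ≤ p := Nat.cast_nonneg _
  have hq1 : 1 ≤ q := by rw [hq]; linarith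
  have hq0 : 0 ≤ q := by linarith
  have hpq : (p : ℝ) ≤ q := by rw [hq]; linarith
  have h2p : 2 * (p : ℝ) + 1 ≤ 2 * q := by rw [hq]; linarith
  have h2p0 : 0 ≤ 2 * (p : ℝ) + 1 := by positivity
  have hA : (2 * (p : ℝ) + 1) ^ 4 ≤ 16 * q ^ 4 := by
    calc (2 * (p : ℝ) + 1) ^ 4 ≤ (2 * q) ^ 4 := pow_le_pow_left₀ h2p0 h2p 4
      _ = 16 * q ^ 4 := by ring
  have hq4 : 1 ≤ q ^ 4 := one_le_pow₀ hq1
  have hB : 2 + 3 * (2 * (p : ℝ) + 1) ^ 4 ≤ 50 * q ^ 4 := by linarith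
  have hC : 6 * (p : ℝ) * (2 * p + 1) ≤ 12 * q ^ 2 := by
    calc 6 * (p : ℝ) * (2 * p + 1) ≤ 6 * q * (2 * q) := by gcongr
      _ = 12 * q ^ 2 := by ring
  have hD : 2 * (p : ℝ) * (2 * p + 1) ≤ 4 * q ^ 2 := by
    calc 2 * (p : ℝ) * (2 * p + 1) ≤ 2 * q * (2 * q) := by gcongr
      _ = 4 * q ^ 2 := by ring
  have hq26 : q ^ 2 ≤ q ^ 6 := pow_le_pow_right₀ hq1 (by norm_num)
  have hprod : (2 + 3 * (2 * (p : ℝ) + 1) ^ 4) * (6 * (p : ℝ) * (2 * p + 1)) ≤ 50 * q ^ 4 * (12 * q ^ 2) :=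
    mul_le_mul hB hC (by positivity) (by positivity)
  calc 2 * (p : ℝ) * (2 * p + 1) + (2 + 3 * (2 * (p : ℝ) + 1) ^ 4) * (6 * (p : ℝ) * (2 * p + 1))
      ≤ 4 * q ^ 2 + 50 * q ^ 4 * (12 * q ^ 2) := add_le_add hD hprod
    _ = 4 * q ^ 2 + 600 * q ^ 6 := by ring
    _ ≤ 4 * q ^ 6 + 600 * q ^ 6 := by linarith
    _ ≤ 2 ^ 10 * q ^ 6 := by nlinarith [pow_nonneg hq0 6]

/-- **Piece 2 — derivative bounds** (registered stub `stub_ptuDerivatives`, verbatim): given coverage `W ≥ 1`, `W` is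
smooth; each piece weight `φ̃/W` is smooth with compact support inside `supp φ̃`; the inner cut-offs obey the
scale-invariant bound `ℓ^j ‖D^j χ‖ ≤ c (c (p+1)(j+1)^4)^j`; the piece weights obey
`‖Dⁿ(φ̃/W)(y)‖ ≤ c (c (p+1)^8 (n+1)^8 / ℓ)ⁿ` for ALL `n` (`ℓ = a · cellSide m`, `c = 2⁴⁰`). [folklore] -/
theorem stub_ptuDerivatives :
    ∃ c : ℝ, 0 < c ∧ ∀ (a : ℝ) (L p : ℕ), 0 < a → IsTriadic L → 1 ≤ L → 2 ≤ p →
      (∀ y : (Fin p → EuclideanSpace ℝ (Fin 4)), 1 ≤ ptuW a L p y) →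
      ContDiff ℝ ∞ (ptuW a L p) ∧
      ∀ m ∈ ptuLevels L p, ∀ vz ∈ ptuIdx L m p,
        ContDiff ℝ ∞ (ptuWeight a L p m vz.1 vz.2) ∧ HasCompactSupport (ptuWeight a L p m vz.1 vz.2) ∧
        tsupport (ptuWeight a L p m vz.1 vz.2) ⊆ tsupport (ptuPhiTilde a m p vz.1 vz.2) ∧
        (∀ (i : Fin p) (j : ℕ) (u : EuclideanSpace ℝ (Fin 4)),
          (a * cellSide m) ^ j * ‖iteratedFDeriv ℝ j (ptuChiFun a m p vz.1 (vz.2 i)) u‖ ≤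
            c * (c * ((p : ℝ) + 1) * ((j : ℝ) + 1) ^ 4) ^ j) ∧
        (∀ (n : ℕ) (y : (Fin p → EuclideanSpace ℝ (Fin 4))),
          ‖iteratedFDeriv ℝ n (ptuWeight a L p m vz.1 vz.2) y‖ ≤
            c * (c * ((p : ℝ) + 1) ^ 8 * ((n : ℝ) + 1) ^ 8 / (a * cellSide m)) ^ n) := by
  refine ⟨2 ^ 40, by positivity, ?_⟩
  intro a L p ha _hT hL hp hW1
  have hWc := ptuDeriv_W_contDiff ha hL p
  refine ⟨hWc, fun m hm vz hvz => ?_⟩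
  have hℓ : 0 < a * cellSide m := by unfold cellSide; positivity
  have hd := ptuDeriv_level_D_ge hm
  have hdpos : (0 : ℝ) < ptuD m p := by exact_mod_cast (show 0 < ptuD m p by omega)
  have hdS := ptuDeriv_cellSide_le_D hm
  have hp1 : (1 : ℝ) ≤ (p : ℝ) + 1 := by linarith [(Nat.cast_nonneg p : (0 : ℝ) ≤ p)]
  have hc1 : (1 : ℝ) ≤ 2 ^ 40 := by norm_num
  have hsupp := ptuDeriv_support_weight_subset a L p m vz.1 vz.2
  refine ⟨?_, (ptuDeriv_phiTilde_hasCompactSupport a m p vz.1 vz.2).mono hsupp, closure_mono hsupp, ?_, ?_⟩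
  · -- smoothness of the piece weight
    show ContDiff ℝ ∞ fun y => ptuPhiTilde a m p vz.1 vz.2 y / ptuW a L p y
    exact (ptuPhiTilde_contDiff a m p vz.1 vz.2).div hWc fun y => by linarith [hW1 y]
  · -- the scale-invariant bound of the inner cut-offs
    intro i j u
    have hw : 0 < a * ((ptuD m p : ℝ) / 8) := by positivity
    have hcut := (ptuDeriv_cut_bound a ((ptuD m p : ℝ) / 8) hw m vz.1 (vz.2 i) (2 + (ptuD m p : ℝ) / 8) j).2 j le_rfl u
    rw [ptuDeriv_ramp_eq] at hcut
    set X : ℝ := 2 ^ 25 * ((j : ℝ) + 1) ^ 2 with hX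
    have hX0 : 0 ≤ X := by positivity
    -- `ℓ · X/(a d) = X · cellSide/d ≤ 2 (2p+1) X`
    have hratio : cellSide m / (ptuD m p : ℝ) ≤ 2 * (2 * (p : ℝ) + 1) := by
      rw [div_le_iff₀ hdpos]; exact hdS
    have hbase : a * cellSide m * (X / (a * ptuD m p)) ≤ 2 ^ 40 * ((p : ℝ) + 1) * ((j : ℝ) + 1) ^ 4 := by
      have heq : a * cellSide m * (X / (a * ptuD m p)) = X * (cellSide m / ptuD m p) := by
        field_simp
      rw [heq]
      have hj1 : (1 : ℝ) ≤ ((j : ℝ) + 1) ^ 2 := by nlinarith [(Nat.cast_nonneg j : (0 : ℝ) ≤ j)]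
      calc X * (cellSide m / ptuD m p) ≤ X * (2 * (2 * (p : ℝ) + 1)) := mul_le_mul_of_nonneg_left hratio hX0
        _ ≤ X * (4 * ((p : ℝ) + 1)) := mul_le_mul_of_nonneg_left (by linarith) hX0
        _ = 2 ^ 27 * ((p : ℝ) + 1) * (((j : ℝ) + 1) ^ 2 * 1) := by rw [hX]; ring
        _ ≤ 2 ^ 40 * ((p : ℝ) + 1) * (((j : ℝ) + 1) ^ 2 * ((j : ℝ) + 1) ^ 2) := by gcongr <;> norm_num
        _ = 2 ^ 40 * ((p : ℝ) + 1) * ((j : ℝ) + 1) ^ 4 := by ring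
    have h0 : 0 ≤ a * cellSide m * (X / (a * ptuD m p)) := by positivity
    calc (a * cellSide m) ^ j * ‖iteratedFDeriv ℝ j (ptuChiFun a m p vz.1 (vz.2 i)) u‖
        ≤ (a * cellSide m) ^ j * (X / (a * ptuD m p)) ^ j := mul_le_mul_of_nonneg_left hcut (pow_nonneg hℓ.le j)
      _ = (a * cellSide m * (X / (a * ptuD m p))) ^ j := by rw [← mul_pow]
      _ ≤ (2 ^ 40 * ((p : ℝ) + 1) * ((j : ℝ) + 1) ^ 4) ^ j := pow_le_pow_left₀ h0 hbase j
      _ ≤ 2 ^ 40 * (2 ^ 40 * ((p : ℝ) + 1) * ((j : ℝ) + 1) ^ 4) ^ j := le_mul_of_one_le_left (by positivity) hc1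
  · -- the piece weights
    intro n y
    have hw := ptuDeriv_weight_bound a L p m ha hL hp hm hW1 vz hvz n y
    refine hw.trans ?_
    have hpoly := stub_ptuDerivatives_poly_le p
    set K : ℝ := 2 * (p : ℝ) * (2 * p + 1) + (2 + 3 * (2 * (p : ℝ) + 1) ^ 4) * (6 * (p : ℝ) * (2 * p + 1)) with hK
    have hK0 : 0 ≤ K := by positivity
    have hn1 : (1 : ℝ) ≤ (n : ℝ) + 1 := by linarith [(Nat.cast_nonneg n : (0 : ℝ) ≤ n)]
    have hbase : ((n : ℝ) + 1) ^ 2 * (K * (2 ^ 25 * ((n : ℝ) + 1) ^ 2 / (a * cellSide m))) ≤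
        2 ^ 40 * ((p : ℝ) + 1) ^ 8 * ((n : ℝ) + 1) ^ 8 / (a * cellSide m) := by
      rw [show ((n : ℝ) + 1) ^ 2 * (K * (2 ^ 25 * ((n : ℝ) + 1) ^ 2 / (a * cellSide m))) =
        ((n : ℝ) + 1) ^ 4 * K * 2 ^ 25 / (a * cellSide m) by ring]
      refine div_le_div_of_nonneg_right ?_ hℓ.le
      have hn48 : ((n : ℝ) + 1) ^ 4 ≤ ((n : ℝ) + 1) ^ 8 := pow_le_pow_right₀ hn1 (by norm_num)
      have hp68 : ((p : ℝ) + 1) ^ 6 ≤ ((p : ℝ) + 1) ^ 8 := pow_le_pow_right₀ hp1 (by norm_num)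
      calc ((n : ℝ) + 1) ^ 4 * K * 2 ^ 25 ≤ ((n : ℝ) + 1) ^ 8 * (2 ^ 10 * ((p : ℝ) + 1) ^ 6) * 2 ^ 25 := by gcongr
        _ ≤ ((n : ℝ) + 1) ^ 8 * (2 ^ 10 * ((p : ℝ) + 1) ^ 8) * 2 ^ 25 := by gcongr
        _ = 2 ^ 35 * ((p : ℝ) + 1) ^ 8 * ((n : ℝ) + 1) ^ 8 := by ring
        _ ≤ 2 ^ 40 * ((p : ℝ) + 1) ^ 8 * ((n : ℝ) + 1) ^ 8 :=
            mul_le_mul_of_nonneg_right (mul_le_mul_of_nonneg_right (by norm_num) (by positivity)) (by positivity)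
    have h0 : 0 ≤ ((n : ℝ) + 1) ^ 2 * (K * (2 ^ 25 * ((n : ℝ) + 1) ^ 2 / (a * cellSide m))) := by positivity
    calc (((n : ℝ) + 1) ^ 2 * (K * (2 ^ 25 * ((n : ℝ) + 1) ^ 2 / (a * cellSide m)))) ^ n
        ≤ (2 ^ 40 * ((p : ℝ) + 1) ^ 8 * ((n : ℝ) + 1) ^ 8 / (a * cellSide m)) ^ n := pow_le_pow_left₀ h0 hbase n
      _ ≤ 2 ^ 40 * (2 ^ 40 * ((p : ℝ) + 1) ^ 8 * ((n : ℝ) + 1) ^ 8 / (a * cellSide m)) ^ n :=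
          le_mul_of_one_le_left (by positivity) hc1

end Summit.QuantumFields.YangMills.Theorems.ContinuumLegGivenGap

end
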